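import Summits.BirchSwinnertonDyer.BirchSwinnertonDyer.Theorems.SignedLowerHalvesSprungLowerDivisibilityAtThreeIotaSharpOfFlat
import Summits.BirchSwinnertonDyer.BirchSwinnertonDyer.Theorems.SignedLowerHalvesSprungLowerDivisibilityAtThreeCyclotomicCommonZeroTheta
import Summits.BirchSwinnertonDyer.BirchSwinnertonDyer.Theorems.SignedLowerHalvesSprungLowerDivisibilityAtThreeCyclotomicCertOfLambda
import Literature.NumberTheory.EllipticCurves.IwasawaAlgebraCharIdealProofs
import HarnessLib

/-!
# Crux `SprungLowerDivisibilityAtThree` (K1, item stmt-BirchSwinnertonDyer-19875), line `chromatic-common-zeros`: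
# at the CYCLOTOMIC primes of positive level the ι-pairing is automatic —
# `Φ_{3^j}(1+T) ∣ L♭ ⟹ Φ_{3^j}(1+T) ∣ L♯` for every X8 Sprung pair (class-wide, input-free)

Cell `bsd-ssimc` (host), width seat `cruxlead-stmt-BirchSwinnertonDyer-19875-w3` (gen 5) under the 19875 lead; `--supports`
19875 `--as helper`; theorems only; closes NO item (skeleton v8 unchanged). K1, BSD and leaf X8 are NOT proved by anything
here. Sequel of `…IotaSharpOfFlat` (p642065: for a prime `𝔭 ∌ 3, T`, `L♯, L♭ ∈ 𝔭 ⟺ L♭, L♭(T^ι) ∈ 𝔭`).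

## What is proved

The primes `(Φ_{3^{k+1}}(1+T)) ⊂ Λ = ℤ₃⟦T⟧` — the locus of stub S4b-cyc — are STABLE under `ι : T ↦ (1+T)⁻¹ − 1`
(`Φ_{3^{k+1}}(1+T^ι) = (1+ι)^{2·3^k}·Φ_{3^{k+1}}(1+T)`, `subst_invOnePlusSubOne_cyclotomicFactor`, p634584) and contain
neither `3` nor `T` (§1). Hence by p642065 the ι-partner condition is void there:

* **`ClassX8.cyclotomic_dvd_sharp_of_dvd_flat`** — for every X8 pair, newform, Sprung pair and `k`:
  `Φ_{3^{k+1}}(1+T) ∣ L♭ ⟹ Φ_{3^{k+1}}(1+T) ∣ L♯`; so a positive-level cyclotomic zero of `L♭` is ALWAYS a common zero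
  (`ClassX8.cyclotomic_dvd_flat_iff_dvd_both`), and (`ClassX8.sharp_mem_of_flat_mem_of_cyclotomic_mem`) the same in the
  height-one-prime currency of the skeleton; the binder «every normalised colour lies in `𝔭`» of S4b-cyc reads `L♭ ∈ 𝔭`
  (`ClassX8.forall_normalised_mem_iff_flat_mem_of_cyclotomic_mem`);
* **`ClassX8.not_cyclotomic_dvd_flat_of_lam_sharp_lt`** — with w2 g3's `λ`-certificate (p623422): `L♯ ≠ 0` and
  `λ(L♯) < φ(3^{k+1})` exclude the level-`(k+1)` cyclotomic zero of `L♭` (the SMALLER-`λ` colour `♯` certifies `♭`);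
* **`ClassX8.twistedLValue_eq_zero_of_cyclotomic_dvd_flat`** — with the lead's exceptional-zero reading (p623344):
  `Φ_{3^j}(1+T) ∣ L♭` ALONE (`j ≥ 1`) forces `L(f, ψ̄, 1) = 0` for every even primitive `p`-power-order `ψ` of modulus
  `3^{j+e₀}` with `ψ(γ)` of exact order `3^j` — the classical exceptional vanishing (Rohrlich-finite per curve).

Not claimed: the converse `Φ ∣ L♯ ⟹ Φ ∣ L♭` (the ♯-row of the pair functional equation has the non-unit factor `g`).

References: [Sprung2017] Prop. 3.14, Thm. 4.13, Cor. 4.4–4.6, Cor. 4.14; [Washington1997] §7.1, §13.2; [MazurTateTeitelbaum1986Invent]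
§I.8 (8.6), §I.17; [Rohrlich1984] Thm.; [Sprung2012] Main Conj. 7.21 (context: stub S4b-cyc of the line).
-/

set_option linter.dupNamespace false
set_option autoImplicit false

noncomputable section

open scoped Classical MatrixGroups ModularForm

open CongruenceSubgroup WeierstrassCurve Polynomial
  Literature.NumberTheory.EllipticCurves Literature.NumberTheory.EllipticCurves.ModularForms
  Literature.NumberTheory.EllipticCurves.Sprung2017 Literature.NumberTheory.EllipticCurves.Rank1Residual
  Literature.Barriers.BirchSwinnertonDyer Summit.BirchSwinnertonDyer.Rank1Residual.Supersingular
  Summit.BirchSwinnertonDyer.Rank1Residual.X1.MuLambda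
  Summit.BirchSwinnertonDyer.BirchSwinnertonDyer.Theorems.ChromaticCommonZeros

namespace Summit.BirchSwinnertonDyer.BirchSwinnertonDyer.Theorems.ChromaticIota

/-! ## §1 The positive-level cyclotomic primes of `Λ = ℤ₃⟦T⟧` are `ι`-stable and contain neither `3` nor `T` -/

section Cyclotomic

/-- `Φ_{3^{k+1}}(1+T) = (1+T)^{2·3^k} + (1+T)^{3^k} + 1` read in `Λ = ℤ₃⟦T⟧`. [cite: Sprung2017, §3.1 (the entries of 𝒞_i)] -/
theorem coe_cyclotomic_comp_eq_powers (k : ℕ) :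
    ((((cyclotomic (3 ^ (k + 1)) ℤ).comp (X + 1)).map (Int.castRingHom ℤ_[3]) : ℤ_[3][X]) : IwasawaAlgebra 3) =
      (1 + PowerSeries.X : IwasawaAlgebra 3) ^ (2 * 3 ^ k) + (1 + PowerSeries.X) ^ 3 ^ k + 1 := by
  rw [cyclotomic_three_pow_succ_comp]
  simp only [Polynomial.map_add, Polynomial.map_pow, Polynomial.map_X, Polynomial.map_one, Polynomial.coe_add,
    Polynomial.coe_pow, Polynomial.coe_X, Polynomial.coe_one, add_comm PowerSeries.X 1]

/-- **The cyclotomic primes are `ι`-stable**: `Φ_{3^{k+1}}(1+T^ι) ∈ (Φ_{3^{k+1}}(1+T))`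
(`Φ_{3^{k+1}}(1+T^ι) = (1+ι)^{2·3^k}·Φ_{3^{k+1}}(1+T)`). [cite: Sprung2017, §3.4 Prop. 3.14] [cite: GreenbergLNM1716, §1] -/
theorem subst_cyclotomic_comp_mem_span (k : ℕ) :
    PowerSeries.subst (invOnePlusSubOne : IwasawaAlgebra 3)
        ((((cyclotomic (3 ^ (k + 1)) ℤ).comp (X + 1)).map (Int.castRingHom ℤ_[3]) : ℤ_[3][X]) : IwasawaAlgebra 3) ∈
      Ideal.span {((((cyclotomic (3 ^ (k + 1)) ℤ).comp (X + 1)).map (Int.castRingHom ℤ_[3]) : ℤ_[3][X]) :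
        IwasawaAlgebra 3)} := by
  rw [coe_cyclotomic_comp_eq_powers, subst_invOnePlusSubOne_cyclotomicFactor]
  exact Ideal.mul_mem_left _ _ (Ideal.subset_span rfl)

/-- `F ∈ (Φ_{3^{k+1}}(1+T)) ⟹ F(T^ι) ∈ (Φ_{3^{k+1}}(1+T))`. [cite: Sprung2017, §3.4 Prop. 3.14] [cite: GreenbergLNM1716, §1] -/
theorem subst_mem_span_cyclotomic_of_mem (k : ℕ) {F : IwasawaAlgebra 3}
    (hF : F ∈ Ideal.span {((((cyclotomic (3 ^ (k + 1)) ℤ).comp (X + 1)).map (Int.castRingHom ℤ_[3]) : ℤ_[3][X]) :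
      IwasawaAlgebra 3)}) :
    PowerSeries.subst (invOnePlusSubOne : IwasawaAlgebra 3) F ∈
      Ideal.span {((((cyclotomic (3 ^ (k + 1)) ℤ).comp (X + 1)).map (Int.castRingHom ℤ_[3]) : ℤ_[3][X]) :
        IwasawaAlgebra 3)} := by
  obtain ⟨h, rfl⟩ := Ideal.mem_span_singleton'.mp hF
  rw [PowerSeries.subst_mul (hasSubst_invOnePlusSubOne (R := ℤ_[3]))]
  exact Ideal.mul_mem_left _ _ (subst_cyclotomic_comp_mem_span k)

/-- `Φ_{3^{k+1}}(1) = 3`: an ideal containing `T` and `Φ_{3^{k+1}}(1+T)` contains `3`. [cite: Washington1997, §7.1] -/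
theorem natCast_mem_of_X_mem_of_cyclotomic_mem (k : ℕ) {J : Ideal (IwasawaAlgebra 3)}
    (hX : (PowerSeries.X : IwasawaAlgebra 3) ∈ J)
    (hΦ : ((((cyclotomic (3 ^ (k + 1)) ℤ).comp (X + 1)).map (Int.castRingHom ℤ_[3]) : ℤ_[3][X]) :
      IwasawaAlgebra 3) ∈ J) :
    ((3 : ℕ) : IwasawaAlgebra 3) ∈ J := by
  set Φ : IwasawaAlgebra 3 :=
    ((((cyclotomic (3 ^ (k + 1)) ℤ).comp (X + 1)).map (Int.castRingHom ℤ_[3]) : ℤ_[3][X]) : IwasawaAlgebra 3)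
    with hΦdef
  have h0 : PowerSeries.constantCoeff (Φ - PowerSeries.C ((3 : ℕ) : ℤ_[3])) = 0 := by
    rw [map_sub, PowerSeries.constantCoeff_C, hΦdef, ← PowerSeries.coeff_zero_eq_constantCoeff_apply,
      Polynomial.coeff_coe, Polynomial.coeff_map, coeff_zero_cyclotomic_three_pow_succ_comp]
    simp
  obtain ⟨q, hq⟩ := PowerSeries.X_dvd_iff.mpr h0
  have hmem : Φ - PowerSeries.C ((3 : ℕ) : ℤ_[3]) ∈ J := by
    rw [hq]
    exact J.mul_mem_right _ hX
  have h3 : PowerSeries.C ((3 : ℕ) : ℤ_[3]) ∈ J := by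
    have := J.sub_mem hΦ hmem
    rwa [sub_sub_cancel] at this
  rwa [map_natCast] at h3

/-- `3 ∉ (Φ_{3^{k+1}}(1+T))` (`Φ` is monic and not a unit, `3` is a prime element of `Λ`). [cite: Washington1997, §7.1 and §13.2] -/
theorem natCast_not_mem_span_cyclotomic (k : ℕ) :
    ((3 : ℕ) : IwasawaAlgebra 3) ∉
      Ideal.span {((((cyclotomic (3 ^ (k + 1)) ℤ).comp (X + 1)).map (Int.castRingHom ℤ_[3]) : ℤ_[3][X]) :
        IwasawaAlgebra 3)} := by
  set q : ℤ_[3][X] := ((cyclotomic (3 ^ (k + 1)) ℤ).comp (X + 1)).map (Int.castRingHom ℤ_[3]) with hqdef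
  have hq : q.Monic := (monic_cyclotomic_comp (p := 3) k).map _
  intro h
  obtain ⟨a, ha⟩ := Ideal.mem_span_singleton'.mp h
  have h3 : ¬ IsUnit ((3 : ℕ) : ℤ_[3]) := by
    rw [PadicInt.isUnit_iff, PadicInt.norm_p]
    norm_num
  have hirr : Irreducible (PowerSeries.C ((3 : ℕ) : ℤ_[3]) : IwasawaAlgebra 3) :=
    (IwasawaAlgebra.prime_C 3).irreducible
  have hfac : (PowerSeries.C ((3 : ℕ) : ℤ_[3]) : IwasawaAlgebra 3) = a * (q : IwasawaAlgebra 3) := by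
    rw [map_natCast, ha]
  rcases hirr.isUnit_or_isUnit hfac with hua | huq
  · -- `q = a⁻¹·3`: the top coefficient `1` of `q` would be divisible by `3`
    obtain ⟨v, hv⟩ := hua
    have hqeq : (q : IwasawaAlgebra 3) = PowerSeries.C ((3 : ℕ) : ℤ_[3]) * ↑v⁻¹ := by
      rw [hfac, ← hv, mul_comm (↑v : IwasawaAlgebra 3), mul_assoc, Units.mul_inv, mul_one]
    have hc := congrArg (PowerSeries.coeff q.natDegree) hqeq
    rw [Polynomial.coeff_coe, hq.coeff_natDegree, PowerSeries.coeff_C_mul] at hc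
    exact h3 (IsUnit.of_mul_eq_one _ hc.symm)
  · -- `q` is not a unit: `q(0) = 3`
    rw [PowerSeries.isUnit_iff_constantCoeff, ← PowerSeries.coeff_zero_eq_constantCoeff_apply, Polynomial.coeff_coe,
      hqdef, Polynomial.coeff_map, coeff_zero_cyclotomic_three_pow_succ_comp] at huq
    exact h3 (by simpa using huq)

/-- `T ∉ (Φ_{3^{k+1}}(1+T))`. [cite: Washington1997, §7.1] -/
theorem X_not_mem_span_cyclotomic (k : ℕ) :
    (PowerSeries.X : IwasawaAlgebra 3) ∉
      Ideal.span {((((cyclotomic (3 ^ (k + 1)) ℤ).comp (X + 1)).map (Int.castRingHom ℤ_[3]) : ℤ_[3][X]) :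
        IwasawaAlgebra 3)} :=
  fun h => natCast_not_mem_span_cyclotomic k (natCast_mem_of_X_mem_of_cyclotomic_mem k h (Ideal.subset_span rfl))

/-- The ideal `(Φ_{3^{k+1}}(1+T))` is prime. [cite: Washington1997, §13.2] -/
theorem isPrime_span_cyclotomic (k : ℕ) :
    (Ideal.span {((((cyclotomic (3 ^ (k + 1)) ℤ).comp (X + 1)).map (Int.castRingHom ℤ_[3]) : ℤ_[3][X]) :
        IwasawaAlgebra 3)}).IsPrime :=
  (Ideal.span_singleton_prime (prime_cyclotomic_comp (p := 3) k).ne_zero).mpr (prime_cyclotomic_comp (p := 3) k)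

end Cyclotomic

/-! ## §2 X8: a positive-level cyclotomic zero of `L♭` is a common zero -/

section X8

/-- **`Φ_{3^{k+1}}(1+T) ∣ L♭ ⟹ Φ_{3^{k+1}}(1+T) ∣ L♯` (X8, class-wide, input-free).** At the ι-stable prime
`(Φ_{3^{k+1}}(1+T)) ∌ 3, T` the partner condition of `ClassX8.sharp_mem_of_flat_mem_of_subst_flat_mem` is automatic.
[cite: Sprung2017, Thm. 4.13, Cor. 4.14, Prop. 3.14 and Cor. 4.6] [cite: Washington1997, §13.2] -/
theorem ClassX8.cyclotomic_dvd_sharp_of_dvd_flat (W : WeierstrassCurve ℚ) [W.IsElliptic] [W.IsGloballyMinimal]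
    (p : ℕ) [Fact p.Prime] (hX : ClassX8 W p) {N : ℕ} [hN : NeZero N] (f : CuspForm (Gamma0 N) 2)
    (hf : IsNewformOf W f) (Lsharp Lflat : IwasawaAlgebra p)
    (hSP : IsSprungPair f p (W.frobeniusTrace p) Lsharp Lflat) (k : ℕ)
    (hfl : ((((cyclotomic (p ^ (k + 1)) ℤ).comp (X + 1)).map (Int.castRingHom ℤ_[p]) : ℤ_[p][X]) :
      IwasawaAlgebra p) ∣ Lflat) :
    ((((cyclotomic (p ^ (k + 1)) ℤ).comp (X + 1)).map (Int.castRingHom ℤ_[p]) : ℤ_[p][X]) : IwasawaAlgebra p) ∣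
      Lsharp := by
  obtain ⟨hp3, -, -⟩ := id hX
  subst hp3
  rw [← Ideal.mem_span_singleton] at hfl ⊢
  exact ClassX8.sharp_mem_of_flat_mem_of_subst_flat_mem W 3 hX f hf Lsharp Lflat hSP _ (isPrime_span_cyclotomic k)
    (natCast_not_mem_span_cyclotomic k) (X_not_mem_span_cyclotomic k) hfl (subst_mem_span_cyclotomic_of_mem k hfl)

/-- **A positive-level cyclotomic zero of `L♭` is a COMMON zero**: `Φ_{3^{k+1}}(1+T) ∣ L♭ ⟺ Φ_{3^{k+1}}(1+T)` divides
both colours. [cite: Sprung2017, Thm. 4.13 and Cor. 4.14] [cite: Sprung2012, Main Conj. 7.21 (context)] -/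
theorem ClassX8.cyclotomic_dvd_flat_iff_dvd_both (W : WeierstrassCurve ℚ) [W.IsElliptic] [W.IsGloballyMinimal]
    (p : ℕ) [Fact p.Prime] (hX : ClassX8 W p) {N : ℕ} [hN : NeZero N] (f : CuspForm (Gamma0 N) 2)
    (hf : IsNewformOf W f) (Lsharp Lflat : IwasawaAlgebra p)
    (hSP : IsSprungPair f p (W.frobeniusTrace p) Lsharp Lflat) (k : ℕ) :
    ((((cyclotomic (p ^ (k + 1)) ℤ).comp (X + 1)).map (Int.castRingHom ℤ_[p]) : ℤ_[p][X]) : IwasawaAlgebra p) ∣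
        Lflat ↔
      (((((cyclotomic (p ^ (k + 1)) ℤ).comp (X + 1)).map (Int.castRingHom ℤ_[p]) : ℤ_[p][X]) : IwasawaAlgebra p) ∣
          Lsharp ∧
        ((((cyclotomic (p ^ (k + 1)) ℤ).comp (X + 1)).map (Int.castRingHom ℤ_[p]) : ℤ_[p][X]) : IwasawaAlgebra p) ∣
          Lflat) :=
  ⟨fun h => ⟨ClassX8.cyclotomic_dvd_sharp_of_dvd_flat W p hX f hf Lsharp Lflat hSP k h, h⟩, fun h => h.2⟩

/-- **Height-one-prime currency (the binder shape of stub S4b-cyc).** For a height-one prime `𝔭` of `Λ` containing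
`Φ_{3^{k+1}}(1+T)`: `L♭ ∈ 𝔭 ⟹ L♯ ∈ 𝔭`. [cite: Sprung2017, Thm. 4.13 and Cor. 4.14] [cite: Washington1997, §13.2] -/
theorem ClassX8.sharp_mem_of_flat_mem_of_cyclotomic_mem (W : WeierstrassCurve ℚ) [W.IsElliptic]
    [W.IsGloballyMinimal] (p : ℕ) [Fact p.Prime] (hX : ClassX8 W p) {N : ℕ} [hN : NeZero N]
    (f : CuspForm (Gamma0 N) 2) (hf : IsNewformOf W f) (Lsharp Lflat : IwasawaAlgebra p)
    (hSP : IsSprungPair f p (W.frobeniusTrace p) Lsharp Lflat) (𝔭 : PrimeSpectrum (IwasawaAlgebra p))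
    (h1 : 𝔭.asIdeal.height = 1) (k : ℕ)
    (hΦ : ((((cyclotomic (p ^ (k + 1)) ℤ).comp (X + 1)).map (Int.castRingHom ℤ_[p]) : ℤ_[p][X]) :
      IwasawaAlgebra p) ∈ 𝔭.asIdeal)
    (hfl : Lflat ∈ 𝔭.asIdeal) : Lsharp ∈ 𝔭.asIdeal := by
  obtain ⟨hp3, -, -⟩ := id hX
  subst hp3
  have heq := Ideal.eq_span_singleton_of_height_eq_one h1 hΦ (prime_cyclotomic_comp (p := 3) k)
  rw [heq, Ideal.mem_span_singleton] at hfl ⊢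
  exact ClassX8.cyclotomic_dvd_sharp_of_dvd_flat W 3 hX f hf Lsharp Lflat hSP k hfl

/-- **The S4b-cyc binder in one-colour currency.** In the binder context of stub S4b-cyc (Néron normalisation by `ϖ`,
`|ϖ|_p = 1`; a height-one prime `𝔭 ∋ Φ_{3^{k+1}}(1+T)`): «every normalised `G^{•′}` of every colour lies in `𝔭`» ⟺
`L♭ ∈ 𝔭`. [cite: Sprung2017, Thm. 4.13 and Cor. 4.14] [cite: Sprung2012, Def. 6.1 and Main Conj. 7.21 (context)] -/
theorem ClassX8.forall_normalised_mem_iff_flat_mem_of_cyclotomic_mem (W : WeierstrassCurve ℚ) [W.IsElliptic]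
    [W.IsGloballyMinimal] (p : ℕ) [Fact p.Prime] (hX : ClassX8 W p) {N : ℕ} [hN : NeZero N]
    (f : CuspForm (Gamma0 N) 2) (hf : IsNewformOf W f) {ϖ : ℚ} (hϖ1 : ‖(ϖ : ℚ_[p])‖ = 1)
    (Lsharp Lflat : IwasawaAlgebra p) (hSP : IsSprungPair f p (W.frobeniusTrace p) Lsharp Lflat)
    (𝔭 : PrimeSpectrum (IwasawaAlgebra p)) (h1 : 𝔭.asIdeal.height = 1) (k : ℕ)
    (hΦ : ((((cyclotomic (p ^ (k + 1)) ℤ).comp (X + 1)).map (Int.castRingHom ℤ_[p]) : ℤ_[p][X]) :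
      IwasawaAlgebra p) ∈ 𝔭.asIdeal) :
    (∀ (col' : Chroma) (G' : IwasawaAlgebra p),
        iwasawaToPowerSeries p G' = PowerSeries.C (ϖ : ℚ_[p]) * iwasawaToPowerSeries p (chromaticL col' Lsharp Lflat) →
        G' ∈ 𝔭.asIdeal) ↔
      Lflat ∈ 𝔭.asIdeal := by
  obtain ⟨hp3, -, -⟩ := id hX
  subst hp3
  have heq := Ideal.eq_span_singleton_of_height_eq_one h1 hΦ (prime_cyclotomic_comp (p := 3) k)
  have hp𝔭 : ((3 : ℕ) : IwasawaAlgebra 3) ∉ 𝔭.asIdeal := heq ▸ natCast_not_mem_span_cyclotomic k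
  have hT : (PowerSeries.X : IwasawaAlgebra 3) ∉ 𝔭.asIdeal := heq ▸ X_not_mem_span_cyclotomic k
  rw [ClassX8.forall_normalised_mem_iff_flat_iotaPair W 3 hX f hf hϖ1 Lsharp Lflat hSP 𝔭.asIdeal 𝔭.isPrime hp𝔭 hT]
  refine ⟨fun h => h.1, fun h => ⟨h, ?_⟩⟩
  rw [heq] at h ⊢
  exact subst_mem_span_cyclotomic_of_mem k h

/-- **The smaller-`λ` colour certifies the other**: `L♯ ≠ 0` and `λ(L♯) < φ(3^{k+1})` ⟹ `Φ_{3^{k+1}}(1+T) ∤ L♭`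
(w2 g3's `λ`-certificate `not_cyclotomic_comp_dvd_of_lam_lt` for `♯`, transported by `cyclotomic_dvd_sharp_of_dvd_flat`).
[cite: Washington1997, §7.1] [cite: Sprung2017, Thm. 4.13] -/
theorem ClassX8.not_cyclotomic_dvd_flat_of_lam_sharp_lt (W : WeierstrassCurve ℚ) [W.IsElliptic]
    [W.IsGloballyMinimal] (p : ℕ) [Fact p.Prime] (hX : ClassX8 W p) {N : ℕ} [hN : NeZero N]
    (f : CuspForm (Gamma0 N) 2) (hf : IsNewformOf W f) (Lsharp Lflat : IwasawaAlgebra p)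
    (hSP : IsSprungPair f p (W.frobeniusTrace p) Lsharp Lflat) (hs0 : Lsharp ≠ 0) (k : ℕ)
    (hlam : lam Lsharp < (p ^ (k + 1)).totient) :
    ¬ ((((cyclotomic (p ^ (k + 1)) ℤ).comp (X + 1)).map (Int.castRingHom ℤ_[p]) : ℤ_[p][X]) : IwasawaAlgebra p) ∣
      Lflat :=
  fun h => not_cyclotomic_comp_dvd_of_lam_lt hs0 k hlam
    (ClassX8.cyclotomic_dvd_sharp_of_dvd_flat W p hX f hf Lsharp Lflat hSP k h)

/-- **A positive-level cyclotomic zero of `L♭` ALONE kills the twisted `L`-values of that conductor.** For an X8 pair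
`(W, 3)` with newform `f`, a Sprung pair `(L♯, L♭)`, `j ≥ 1` with `Φ_{3^j}(1+T) ∣ L♭`, and `ψ` a primitive even Dirichlet
character of `3`-power order modulo `3^{j+e₀}` (values in a field `K ↪ ℂ, ℂ₃`) with `ψ(γ)` a primitive `3^j`-th root of
unity: the entire continuation `L` of `L(f, (σψ)⁻¹, s)` has `L(1) = 0` (the lead's `twistedLValue_eq_zero_of_cyclotomic_comp_dvd`
fed by `cyclotomic_dvd_sharp_of_dvd_flat`). [cite: MazurTateTeitelbaum1986Invent, §I.8 (8.6)] [cite: Sprung2017, Cor. 4.4, Thm. 1.12]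
[cite: Rohrlich1984, Thm. (finiteness of the exceptional set)] -/
theorem ClassX8.twistedLValue_eq_zero_of_cyclotomic_dvd_flat (W : WeierstrassCurve ℚ) [W.IsElliptic]
    [W.IsGloballyMinimal] (p : ℕ) [Fact p.Prime] (hX : ClassX8 W p) {N : ℕ} [hN : NeZero N]
    (f : CuspForm (Gamma0 N) 2) (hf : IsNewformOf W f) (Lsharp Lflat : IwasawaAlgebra p)
    (hSP : IsSprungPair f p (W.frobeniusTrace p) Lsharp Lflat) {j : ℕ} (hj : 1 ≤ j)
    (hfl : ((((cyclotomic (p ^ j) ℤ).comp (X + 1)).map (Int.castRingHom ℤ_[p]) : ℤ_[p][X]) :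
      IwasawaAlgebra p) ∣ Lflat)
    {K : Type*} [Field K] (σ : K →+* ℂ) (τ : K →+* ℂ_[p])
    (ψ : DirichletCharacter K (p ^ (j + cyclotomicExponent p))) (hprim : ψ.IsPrimitive) (hev : ψ.Even)
    (hord : ∃ i : ℕ, orderOf ψ = p ^ i)
    (hζ : IsPrimitiveRoot (ψ (cyclotomicGenerator p : ZMod (p ^ (j + cyclotomicExponent p)))) (p ^ j))
    {L : ℂ → ℂ} (hLd : Differentiable ℂ L)
    (hL : ∀ s : ℂ, 2 < s.re → L s = twistedLSeries f (ψ.ringHomComp σ)⁻¹ s) :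
    L 1 = 0 := by
  haveI : NeZero N := hN
  obtain ⟨k, rfl⟩ : ∃ k, j = k + 1 := ⟨j - 1, by omega⟩
  exact twistedLValue_eq_zero_of_cyclotomic_comp_dvd (f := f) σ τ hf.1 hf.coeffField_eq_bot hSP
    (ClassX8.cyclotomic_dvd_sharp_of_dvd_flat W p hX f hf Lsharp Lflat hSP k hfl) hfl ψ hprim hev hord hζ hLd hL

end X8

end Summit.BirchSwinnertonDyer.BirchSwinnertonDyer.Theorems.ChromaticIota

end
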